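import Summits.QuantumFields.YangMills.Theorems.FluctuationComparisonRegPrIntLS2BetaCanonicalCurrency
import Summits.QuantumFields.YangMills.Theorems.FluctuationComparisonRegPrIntLS2BetaKPLogRep
import HarnessLib

/-!
# A.E. ⇒ CANONICAL TRANSFER FOR THE GAS IDENTITY: an identity `heightDensity S₁ = e^{cst}·heightDensity S₀·Ξ(w)` holding `dU`-A.E. on an open window, with a Kotecký–Preiss
# gas of CONTINUOUS activities, IS the pointwise identity of LFG^{can}∕LFG^{can}∘ between the canonical versions — the bridge from the 𝐑-operation's a.e. letters to the display

Cell `ym3-torus` (HUMAN RULING D-0037: rung R3 = continuum `SU(2)` Yang–Mills on `T³` — NOT `d = 4`, NOT infinite volume, NOT a mass gap, NOT the Clay problem); width seat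
`ym3-torus-px10` (gen 16); helper of the crux `stmt-QuantumFields-20520` `UnitScaleTilt.FluctuationComparisonRegPrIntL` (`--supports … --as helper`, NOT a proof of it); LOCATE
`LOCATE-LFG-px10g16.md` (20520 evidence #41) piece (G5); FILE 4 (✓FILE 1 `…LargeFieldGasCanonicalCurrency` p785586, ✓FILE 2 `…LargeFieldGasInteriorDoor` p785895, ✓FILE 3
`…LargeFieldGasWindowCut` p786068).  THEOREMS ONLY: 0 `def`, 0 `instance`, 0 `notation`, 0 `sorry`, default heartbeats.

WHY.  Every tree supplier a hand on the 𝐑-operation can use speaks of the honest `L¹` densities `heightDensity F γ hJK S` up to `dU`-null sets (the Radon–Nikodym transports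
`T3UnitLawDensityEML.rt`, ✓`integral_resDensity_mul`, ✓`resDensity_union_ae`, ✓`…HistoryPartition.heightDensity_eq_sum_histories_ae`, ✓FILE 3), whereas the display LFG^{can}∘
(the hypothesis of ✓`…LargeFieldGasInteriorDoor.largeFieldFourPtIntCan_of_canInt`) is a POINTWISE identity between CANONICAL VERSIONS `heightDensityCan` on the window.  The passage
is [Balaban1987RG1] (0.13) p.254's «continuous versions» read through ✓`Node00.canonVersion_eqOn_of_continuousOn` — valid as soon as the gas `U ↦ Ξ(w_U)` is continuous and
non-vanishing on the window: continuity from CONTINUOUS ACTIVITIES (print's `𝐑′(X)` are analytic functions of the background, [Balaban1989LargeFieldII] p.390), positivity from the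
Kotecký–Preiss block itself (KPL-A ✓`re_polymerPartitionFunction_pos_of_kp`).

* §1 `gasZ_pos_of_kpGas` — under the δ-unfolded `KPGasOn W κ N w` block (`κ ≥ 0`), `0 < Ξ(w_U)` at every `U ∈ W` (KPL-D's route: the majorant gas is a KP volume, ✓`isKPVolume_of_norm_le`,
  ✓`re_polymerPartitionFunction_pos_of_kp`); `continuousOn_gasZ` — activities continuous on `W` ⇒ `U ↦ Ξ(w_U)` continuous on `W` (a finite sum of finite products).
* §2 (ymfull-r3-prover-1 g0's RATIO SHAPE (b), 20:16:46Z) ★`heightDensityCan_ratio_of_ae` — OPEN `W ⊆ regSet (heightDensity S₀)`, `R` continuous on `W`,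
  `heightDensity S₁ = heightDensity S₀·R` a.e. on `W` ⇒ `W ⊆ regSet (heightDensity S₁)` ∧ `heightDensityCan S₁ = heightDensityCan S₀·R` POINTWISE on `W`; ★`heightDensityCan_ratio_of_ae'`
  — the same from (r1) `W ⊆ regSet (heightDensity S₁)` and `R > 0` on `W` (then `W ⊆ regSet (heightDensity S₀)` is a CONCLUSION); `ae_eq_mul_sum_of_ae_ratios` — the «second door»:
  per-history a.e. ratios `g i = h·r i` and `f = Σ g i` a.e. on `W` ⇒ `f = h·Σ r i` a.e. on `W` (generic); ★★`heightDensityCan_gasIdentity_of_ae` — the gas case `R = e^{cst}·Ξ(w)`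
  with positivity of `Ξ` DERIVED (§1): a.e. identity + continuous activities + (r1) ⇒ `W ⊆ regSet (heightDensity S₀)` ∧ the pointwise canonical identity.
* §3 ★★`canInt_body_of_ae` — the same packaged as the ∃-body of LFG^{can}∘ at one `(J, K)` and one interior window `W_J^{c} = {PlaqSmall (θBal F.L γ (c·b₀) p₀ J)}` (`S₁ = univ`,
  `S₀ = histGood (θBal b₀) K J`): from «∃ cst w, KPGasOn W_J^{c} κ (Ψ J) w ∧ activities continuous on W_J^{c} ∧ the identity A.E. on W_J^{c}» and (r1∘) to «∃ cst w, KPGasOn … ∧ the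
  identity POINTWISE on W_J^{c}» — the text ✓`largeFieldFourPtIntCan_of_canInt` consumes after its three rows.
* §4 ★★`canInt_of_aeInt : ⟨LFG^{ae}∘⟩ → ⟨LFG^{can}∘ VERBATIM⟩` — the whole display: LFG^{ae}∘ = LFG^{can}∘ with the conclusion asked only A.E. between the honest densities, plus
  continuity of the activities; so `stub_largeFieldFourPtIntCan := largeFieldFourPtIntCan_of_canInt (canInt_of_aeInt h)` for any proof `h` of LFG^{ae}∘.

WHAT IT BUYS (honest; CREDITS NOTHING): the 𝐑-operation hand (ymfull-r3-prover-1, R600) may deliver its gas identity A.E. with continuous activities; this file and FILE 2 carry it to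
the registered stub.  NOTHING of the 𝐑-operation is touched; LFG∕LFG^{can}∘∕`stub_largeFieldFourPtIntCan`∕S2β, the crux 20520, EX∕19200, 19936 NOT proved; `YM3TorusSU2` NOT
proved; the Yang–Mills mass gap (Clay) NOT proved; rung R3 = YM₃ on `T³` — NOT `d = 4`, NOT infinite volume, NOT a mass gap.
References: [Balaban1987RG1] T. Bałaban, CMP 109 (1987) (0.13) p.254; [Balaban1989LargeFieldII] CMP 122 (1989) (1.90) p.388, (1.97)–(1.101) pp.389–390; [Balaban1985UV3]
CMP 102 (1985) (2) p.256, (41) p.266; [KoteckyPreiss1986] CMP 103 (1986), Theorem p.492 (1)–(2).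
-/

set_option autoImplicit false

noncomputable section

open MeasureTheory Filter Topology Set
open scoped ENNReal
open Literature.Probability.LatticeModels (polyInc polymerPartitionFunction IsKPVolume kpTerm)
open Literature.MathematicalPhysics.QuantumFieldTheory.Balaban1983to89
open Literature.MathematicalPhysics.QuantumFieldTheory.Balaban1983to89.T3ContinuumYM3Torus
open Literature.MathematicalPhysics.QuantumFieldTheory.Balaban1983to89.T3NestedUnitLaws
open Literature.MathematicalPhysics.QuantumFieldTheory.Balaban1983to89.T3UnitLawDensityEML
open Literature.MathematicalPhysics.QuantumFieldTheory.Balaban1983to89.T3UnitScaleTilt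
open Literature.MathematicalPhysics.QuantumFieldTheory.Balaban1983to89.T3TiltDescent
open Literature.MathematicalPhysics.QuantumFieldTheory.Balaban1983to89.T3PrintedRegularMinimiser
open Literature.MathematicalPhysics.QuantumFieldTheory.Balaban1983to89.T3LevelShift
open Literature.MathematicalPhysics.QuantumFieldTheory.Balaban1983to89.Missing
open Literature.MathematicalPhysics.QuantumFieldTheory.Balaban1983to89.T4Continuum
open scoped Literature.MathematicalPhysics.QuantumFieldTheory.Balaban1983to89.T3OrbitAverage
open Summit.QuantumFields.YangMills.Theorems.FluctuationComparisonRegPrIntLWregGlue (heightDensityCan)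
open Summit.QuantumFields.YangMills.Theorems.FluctuationComparisonRegPrIntLS2BetaKPLIncrement (re_polymerPartitionFunction_pos_of_kp)
open Summit.QuantumFields.YangMills.Theorems.FluctuationComparisonRegPrIntLS2BetaKPLExpansion (isKPVolume_of_norm_le)

namespace Summit.QuantumFields.YangMills.Theorems.FluctuationComparisonRegPrIntLLargeFieldGasCanonicalTransfer

/-! ## §1 The gas partition function of a Kotecký–Preiss gas is positive on the window; continuous activities give a continuous gas -/

section Gas

variable {P : Params}

open Classical in
/-- **A KOTECKÝ–PREISS GAS HAS `Ξ(w_U) > 0` ON ITS WINDOW** (KPL-D's route: the field-independent majorant `w̄` is a KP volume on all polymers, every `w_U`, `U ∈ W`, is dominated by it,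
✓`isKPVolume_of_norm_le`, and a real KP volume has positive partition function, ✓`re_polymerPartitionFunction_pos_of_kp`). [cite: KoteckyPreiss1986, Theorem p.492 (1)-(2)] -/
theorem gasZ_pos_of_kpGas (W : Set (GaugeField P 0 (Matrix.specialUnitaryGroup (Fin 2) ℂ))) {κ : ℝ} (N : ℝ) (hκ : 0 ≤ κ)
    (w : GaugeField P 0 (Matrix.specialUnitaryGroup (Fin 2) ℂ) → Finset (PBond P 0) → ℝ)
    (hgas : ∃ (wbar a ℓ : Finset (PBond P 0) → ℝ),
      (∀ U, w U ∅ = 0) ∧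
      (∀ (X : Finset (PBond P 0)) (U U' : GaugeField P 0 (Matrix.specialUnitaryGroup (Fin 2) ℂ)),
        (∀ e ∈ X, U e = U' e) → w U X = w U' X) ∧
      (∀ X, 0 ≤ a X) ∧ (∀ X, 0 ≤ ℓ X) ∧
      (∀ U, U ∈ W → ∀ X, |w U X| ≤ wbar X) ∧
      (∀ X : Finset (PBond P 0), ∀ e ∈ X, ∀ e' ∈ X, (e.src.tdist e'.src : ℝ) ≤ ℓ X) ∧
      (∀ X : Finset (PBond P 0), ∑ X' ∈ Finset.univ.filter (fun X' => polyInc X' X),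
          wbar X' * Real.exp (a X' + κ * ℓ X') ≤ a X) ∧
      (∀ e : PBond P 0, a {e} ≤ N)) :
    ∀ U, U ∈ W → 0 < (polymerPartitionFunction polyInc (fun X : Finset (PBond P 0) => ((w U X : ℝ) : ℂ)) Finset.univ).re := by
  intro U hU
  obtain ⟨wbar, a, ℓ, -, -, -, hℓ, hdom, -, hKP, -⟩ := hgas
  have hwbar0 : ∀ X, 0 ≤ wbar X := fun X => (abs_nonneg _).trans (hdom U hU X)
  have hKP0 : IsKPVolume polyInc (fun X => ((wbar X : ℝ) : ℂ)) a (Finset.univ : Finset (Finset (PBond P 0))) := by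
    intro X _
    refine le_trans (Finset.sum_le_sum fun X' _ => ?_) (hKP X)
    unfold kpTerm
    rw [Complex.norm_real, Real.norm_eq_abs, abs_of_nonneg (hwbar0 X')]
    refine mul_le_mul_of_nonneg_left (Real.exp_le_exp.2 ?_) (hwbar0 X')
    linarith [mul_nonneg hκ (hℓ X')]
  have hwcle : ∀ X ∈ (Finset.univ : Finset (Finset (PBond P 0))), ‖((w U X : ℝ) : ℂ)‖ ≤ wbar X := fun X _ => by
    rw [Complex.norm_real, Real.norm_eq_abs]; exact hdom U hU X
  have hKPU : IsKPVolume polyInc (fun X : Finset (PBond P 0) => ((w U X : ℝ) : ℂ)) a (Finset.univ : Finset (Finset (PBond P 0))) :=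
    isKPVolume_of_norm_le hKP0 hwbar0 hwcle
  exact re_polymerPartitionFunction_pos_of_kp hKPU subset_rfl

open Classical in
/-- **CONTINUOUS ACTIVITIES GIVE A CONTINUOUS GAS**: if every `U ↦ w_U(X)` is continuous on `W`, so is `U ↦ Ξ(w_U)` (a finite sum over compatible families of finite products).
[cite: Balaban1989LargeFieldII, (1.90) p.388] -/
theorem continuousOn_gasZ (W : Set (GaugeField P 0 (Matrix.specialUnitaryGroup (Fin 2) ℂ)))
    (w : GaugeField P 0 (Matrix.specialUnitaryGroup (Fin 2) ℂ) → Finset (PBond P 0) → ℝ)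
    (hw : ∀ X, ContinuousOn (fun U => w U X) W) :
    ContinuousOn (fun U => (polymerPartitionFunction polyInc (fun X : Finset (PBond P 0) => ((w U X : ℝ) : ℂ)) Finset.univ).re) W := by
  refine Complex.continuous_re.comp_continuousOn ?_
  unfold polymerPartitionFunction
  refine continuousOn_finsetSum _ fun A _ => ?_
  by_cases hA : Literature.Probability.LatticeModels.IsCompatible polyInc A
  · simp only [if_pos hA]
    exact continuousOn_finsetProd _ fun X _ => Complex.continuous_ofReal.comp_continuousOn (hw X)
  · simp only [if_neg hA]
    exact continuousOn_const

end Gas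

/-! ## §2 The transfer in RATIO FORM (prover-1's shape (b)): an a.e. identity `heightDensity S₁ = heightDensity S₀·R` on an open window with `R` continuous there -/

section Transfer

variable (F : T3Family) {γ : ℝ} {J K : ℕ} (hJK : J ≤ K)

/-- **RATIO TRANSFER, the cut density regular** (shape (b) of ymfull-r3-prover-1 g0): on an OPEN `W`, if `W ⊆ regSet (heightDensity S₀)`, `R` is continuous on `W` and
`heightDensity S₁ = heightDensity S₀·R` `dU`-a.e. on `W`, then `W ⊆ regSet (heightDensity S₁)` and `heightDensityCan S₁ = heightDensityCan S₀·R` at EVERY point of `W`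
(`heightDensityCan S₀·R` is a continuous a.e.-version of `heightDensity S₁` on `W`; ✓`Node00.canonVersion_eqOn_of_continuousOn`). [cite: Balaban1987RG1, (0.13) p.254] -/
theorem heightDensityCan_ratio_of_ae {W : Set (GaugeField (F.P J) 0 (Matrix.specialUnitaryGroup (Fin 2) ℂ))} (hWo : IsOpen W)
    (S₁ S₀ : Set (GaugeField (F.P K) 0 (Matrix.specialUnitaryGroup (Fin 2) ℂ))) (R : GaugeField (F.P J) 0 (Matrix.specialUnitaryGroup (Fin 2) ℂ) → ℝ)
    (hR₀ : W ⊆ Node00.regSet (fieldMeasure (F.P J) 0 (Matrix.specialUnitaryGroup (Fin 2) ℂ)) (heightDensity F γ hJK S₀))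
    (hRc : ContinuousOn R W)
    (hae : ∀ᵐ U ∂fieldMeasure (F.P J) 0 (Matrix.specialUnitaryGroup (Fin 2) ℂ), U ∈ W →
      heightDensity F γ hJK S₁ U = heightDensity F γ hJK S₀ U * R U) :
    W ⊆ Node00.regSet (fieldMeasure (F.P J) 0 (Matrix.specialUnitaryGroup (Fin 2) ℂ)) (heightDensity F γ hJK S₁) ∧
    ∀ U, U ∈ W → heightDensityCan F γ hJK S₁ U = heightDensityCan F γ hJK S₀ U * R U := by
  haveI := B12ContinuousTransportInvariance.isOpenPosMeasure_fieldMeasure_SU (N := 2) (F.P J) 0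
  set μ := fieldMeasure (F.P J) 0 (Matrix.specialUnitaryGroup (Fin 2) ℂ) with hμ
  have h0c : ContinuousOn (heightDensityCan F γ hJK S₀) W := Node00.continuousOn_canonVersion.mono hR₀
  have hgc : ContinuousOn (fun U => heightDensityCan F γ hJK S₀ U * R U) W := h0c.mul hRc
  have h0ae : heightDensityCan F γ hJK S₀ =ᵐ[μ.restrict W] heightDensity F γ hJK S₀ := ae_restrict_of_ae Node00.canonVersion_ae_eq
  have hae' : ∀ᵐ U ∂μ.restrict W, heightDensity F γ hJK S₁ U = heightDensity F γ hJK S₀ U * R U := (ae_restrict_iff' hWo.measurableSet).mpr hae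
  have hgae : (fun U => heightDensityCan F γ hJK S₀ U * R U) =ᵐ[μ.restrict W] heightDensity F γ hJK S₁ := by
    filter_upwards [h0ae, hae'] with U hU0 hU
    rw [hU, hU0]
  have hEq : EqOn (heightDensityCan F γ hJK S₁) (fun U => heightDensityCan F γ hJK S₀ U * R U) W :=
    Node00.canonVersion_eqOn_of_continuousOn hWo hgc hgae
  exact ⟨Node00.subset_regSet hWo ⟨_, hgc, hgae⟩, fun U hU => hEq hU⟩

/-- **RATIO TRANSFER, the full density regular and the ratio positive**: on an OPEN `W`, if `W ⊆ regSet (heightDensity S₁)` (row (r1)), `R` is continuous and POSITIVE on `W`,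
and `heightDensity S₁ = heightDensity S₀·R` `dU`-a.e. on `W`, then `W ⊆ regSet (heightDensity S₀)` (`heightDensityCan S₁∕R` is a continuous version) and the pointwise identity
holds. [cite: Balaban1987RG1, (0.13) p.254] -/
theorem heightDensityCan_ratio_of_ae' {W : Set (GaugeField (F.P J) 0 (Matrix.specialUnitaryGroup (Fin 2) ℂ))} (hWo : IsOpen W)
    (S₁ S₀ : Set (GaugeField (F.P K) 0 (Matrix.specialUnitaryGroup (Fin 2) ℂ))) (R : GaugeField (F.P J) 0 (Matrix.specialUnitaryGroup (Fin 2) ℂ) → ℝ)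
    (hR₁ : W ⊆ Node00.regSet (fieldMeasure (F.P J) 0 (Matrix.specialUnitaryGroup (Fin 2) ℂ)) (heightDensity F γ hJK S₁))
    (hRc : ContinuousOn R W) (hRpos : ∀ U, U ∈ W → 0 < R U)
    (hae : ∀ᵐ U ∂fieldMeasure (F.P J) 0 (Matrix.specialUnitaryGroup (Fin 2) ℂ), U ∈ W →
      heightDensity F γ hJK S₁ U = heightDensity F γ hJK S₀ U * R U) :
    W ⊆ Node00.regSet (fieldMeasure (F.P J) 0 (Matrix.specialUnitaryGroup (Fin 2) ℂ)) (heightDensity F γ hJK S₀) ∧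
    ∀ U, U ∈ W → heightDensityCan F γ hJK S₁ U = heightDensityCan F γ hJK S₀ U * R U := by
  haveI := B12ContinuousTransportInvariance.isOpenPosMeasure_fieldMeasure_SU (N := 2) (F.P J) 0
  set μ := fieldMeasure (F.P J) 0 (Matrix.specialUnitaryGroup (Fin 2) ℂ) with hμ
  have h1c : ContinuousOn (heightDensityCan F γ hJK S₁) W := Node00.continuousOn_canonVersion.mono hR₁
  have hgc : ContinuousOn (fun U => heightDensityCan F γ hJK S₁ U / R U) W := h1c.div hRc fun U hU => (hRpos U hU).ne'
  have h1ae : heightDensityCan F γ hJK S₁ =ᵐ[μ.restrict W] heightDensity F γ hJK S₁ := ae_restrict_of_ae Node00.canonVersion_ae_eq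
  have hae' : ∀ᵐ U ∂μ.restrict W, heightDensity F γ hJK S₁ U = heightDensity F γ hJK S₀ U * R U := (ae_restrict_iff' hWo.measurableSet).mpr hae
  have hgae : (fun U => heightDensityCan F γ hJK S₁ U / R U) =ᵐ[μ.restrict W] heightDensity F γ hJK S₀ := by
    filter_upwards [h1ae, hae', ae_restrict_mem hWo.measurableSet] with U hU1 hU hUW
    rw [hU1, hU, mul_div_assoc, div_self (hRpos U hUW).ne', mul_one]
  have hR₀ : W ⊆ Node00.regSet μ (heightDensity F γ hJK S₀) := Node00.subset_regSet hWo ⟨_, hgc, hgae⟩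
  exact ⟨hR₀, (heightDensityCan_ratio_of_ae F hJK hWo S₁ S₀ R hR₀ hRc hae).2⟩

/-- **THE A.E. KNIT OF THE HISTORY RATIOS** (prover-1's «second door»): if `f = Σ_{i ∈ s} g i` a.e. on `W` and `g i = h·r i` a.e. on `W` for every `i ∈ s`, then `f = h·Σ_{i ∈ s} r i`
a.e. on `W` (any measure, any finite index set; with `f, g, h` the height densities of `univ`, of the histories, of the trivial history — ✓FILE 3 `…_ae_eq_sum_deep_on_window`).
[cite: Balaban1985UV3, (41) p.266] -/
theorem ae_eq_mul_sum_of_ae_ratios {α ι : Type*} [MeasurableSpace α] (μ : Measure α) (W : Set α) (s : Finset ι)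
    (f h : α → ℝ) (g r : ι → α → ℝ)
    (hsum : ∀ᵐ x ∂μ, x ∈ W → f x = ∑ i ∈ s, g i x) (hrat : ∀ i ∈ s, ∀ᵐ x ∂μ, x ∈ W → g i x = h x * r i x) :
    ∀ᵐ x ∂μ, x ∈ W → f x = h x * ∑ i ∈ s, r i x := by
  classical
  have hall : ∀ᵐ x ∂μ, ∀ i ∈ s, x ∈ W → g i x = h x * r i x :=
    (ae_ball_iff s.countable_toSet).mpr fun i hi => hrat i hi
  filter_upwards [hsum, hall] with x hx hxall hxW
  rw [hx hxW, Finset.mul_sum]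
  exact Finset.sum_congr rfl fun i hi => hxall i hi hxW

open Classical in
/-- ★★ **A.E. ⇒ CANONICAL FOR THE GAS IDENTITY.**  On an OPEN window `W`: if the activities are continuous on `W` and form a Kotecký–Preiss gas there (`κ ≥ 0`), if
`heightDensity S₁ = e^{cst}·heightDensity S₀·Ξ(w)` `dU`-a.e. on `W`, and if `W ⊆ regSet (heightDensity S₁)` (row (r1)), then `W ⊆ regSet (heightDensity S₀)` and the identity holds
POINTWISE on `W` between the canonical versions (§1: `Ξ` is continuous and positive on `W`; then `heightDensityCan_ratio_of_ae'` with `R = e^{cst}·Ξ`).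
[cite: Balaban1987RG1, (0.13) p.254; Balaban1989LargeFieldII, (1.90) p.388] -/
theorem heightDensityCan_gasIdentity_of_ae {W : Set (GaugeField (F.P J) 0 (Matrix.specialUnitaryGroup (Fin 2) ℂ))} (hWo : IsOpen W)
    (S₁ S₀ : Set (GaugeField (F.P K) 0 (Matrix.specialUnitaryGroup (Fin 2) ℂ))) (cst : ℝ) {κ : ℝ} (N : ℝ) (hκ : 0 ≤ κ)
    (w : GaugeField (F.P J) 0 (Matrix.specialUnitaryGroup (Fin 2) ℂ) → Finset (PBond (F.P J) 0) → ℝ)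
    (hgas : ∃ (wbar a ℓ : Finset (PBond (F.P J) 0) → ℝ),
      (∀ U, w U ∅ = 0) ∧
      (∀ (X : Finset (PBond (F.P J) 0)) (U U' : GaugeField (F.P J) 0 (Matrix.specialUnitaryGroup (Fin 2) ℂ)),
        (∀ e ∈ X, U e = U' e) → w U X = w U' X) ∧
      (∀ X, 0 ≤ a X) ∧ (∀ X, 0 ≤ ℓ X) ∧
      (∀ U, U ∈ W → ∀ X, |w U X| ≤ wbar X) ∧
      (∀ X : Finset (PBond (F.P J) 0), ∀ e ∈ X, ∀ e' ∈ X, (e.src.tdist e'.src : ℝ) ≤ ℓ X) ∧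
      (∀ X : Finset (PBond (F.P J) 0), ∑ X' ∈ Finset.univ.filter (fun X' => polyInc X' X),
          wbar X' * Real.exp (a X' + κ * ℓ X') ≤ a X) ∧
      (∀ e : PBond (F.P J) 0, a {e} ≤ N))
    (hw : ∀ X, ContinuousOn (fun U => w U X) W)
    (hae : ∀ᵐ U ∂fieldMeasure (F.P J) 0 (Matrix.specialUnitaryGroup (Fin 2) ℂ), U ∈ W →
      heightDensity F γ hJK S₁ U = Real.exp cst * heightDensity F γ hJK S₀ U *
        (polymerPartitionFunction polyInc (fun X : Finset (PBond (F.P J) 0) => ((w U X : ℝ) : ℂ)) Finset.univ).re)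
    (hR : W ⊆ Node00.regSet (fieldMeasure (F.P J) 0 (Matrix.specialUnitaryGroup (Fin 2) ℂ)) (heightDensity F γ hJK S₁)) :
    W ⊆ Node00.regSet (fieldMeasure (F.P J) 0 (Matrix.specialUnitaryGroup (Fin 2) ℂ)) (heightDensity F γ hJK S₀) ∧
    ∀ U, U ∈ W → heightDensityCan F γ hJK S₁ U = Real.exp cst * heightDensityCan F γ hJK S₀ U *
      (polymerPartitionFunction polyInc (fun X : Finset (PBond (F.P J) 0) => ((w U X : ℝ) : ℂ)) Finset.univ).re := by
  set Ξ : GaugeField (F.P J) 0 (Matrix.specialUnitaryGroup (Fin 2) ℂ) → ℝ :=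
    fun U => (polymerPartitionFunction polyInc (fun X : Finset (PBond (F.P J) 0) => ((w U X : ℝ) : ℂ)) Finset.univ).re with hΞ
  have hΞpos : ∀ U, U ∈ W → 0 < Ξ U := gasZ_pos_of_kpGas W N hκ w hgas
  have hΞc : ContinuousOn Ξ W := continuousOn_gasZ W w hw
  have hRc : ContinuousOn (fun U => Real.exp cst * Ξ U) W := continuousOn_const.mul hΞc
  have hRpos : ∀ U, U ∈ W → 0 < Real.exp cst * Ξ U := fun U hU => mul_pos (Real.exp_pos _) (hΞpos U hU)
  have hae2 : ∀ᵐ U ∂fieldMeasure (F.P J) 0 (Matrix.specialUnitaryGroup (Fin 2) ℂ), U ∈ W →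
      heightDensity F γ hJK S₁ U = heightDensity F γ hJK S₀ U * (Real.exp cst * Ξ U) := by
    filter_upwards [hae] with U hU hUW
    rw [hU hUW]; ring
  obtain ⟨hR₀, hid⟩ := heightDensityCan_ratio_of_ae' F hJK hWo S₁ S₀ (fun U => Real.exp cst * Ξ U) hR hRc hRpos hae2
  exact ⟨hR₀, fun U hU => by rw [hid U hU]; ring⟩

end Transfer

/-! ## §3 The ∃-body of LFG^{can}∘ from an a.e. gas identity with continuous activities -/

section Body

variable (F : T3Family) {γ : ℝ} (b₀ p₀ c : ℝ) {J K : ℕ} (hJK : J ≤ K)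

open Classical in
/-- ★★ **LFG^{can}∘'s ∃-BODY AT ONE `(J, K)` FROM THE A.E. LETTERS**: given the row (r1∘) on the interior window `W_J^{c}` and «`∃ cst w`, a Kotecký–Preiss gas on `W_J^{c}` at rate
`κ ≥ 0` with pinned size `Ψ J`, activities continuous on `W_J^{c}`, and `heightDensity univ = e^{cst}·heightDensity histGood(b₀)·Ξ(w)` `dU`-A.E. on `W_J^{c}`», the POINTWISE canonical
identity of LFG^{can}∘ holds with the SAME `cst, w` — the text ✓`…LargeFieldGasInteriorDoor.largeFieldFourPtIntCan_of_canInt` consumes.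
[cite: Balaban1989LargeFieldII, (1.90) p.388 and (1.100)-(1.101) p.390; Balaban1987RG1, (0.13) p.254] -/
theorem canInt_body_of_ae {κ : ℝ} (hκ : 0 ≤ κ) (Ψ : ℕ → ℝ)
    (hR : {U : GaugeField (F.P J) 0 (Matrix.specialUnitaryGroup (Fin 2) ℂ) | PlaqSmall (θBal F.L γ (c * b₀) p₀ J) U} ⊆
      Node00.regSet (fieldMeasure (F.P J) 0 (Matrix.specialUnitaryGroup (Fin 2) ℂ)) (heightDensity F γ hJK Set.univ))
    (h : ∃ (cst : ℝ) (w : GaugeField (F.P J) 0 (Matrix.specialUnitaryGroup (Fin 2) ℂ) → Finset (PBond (F.P J) 0) → ℝ),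
      (∃ (wbar a ℓ : Finset (PBond (F.P J) 0) → ℝ),
        (∀ U, w U ∅ = 0) ∧
        (∀ (X : Finset (PBond (F.P J) 0)) (U U' : GaugeField (F.P J) 0 (Matrix.specialUnitaryGroup (Fin 2) ℂ)),
          (∀ e ∈ X, U e = U' e) → w U X = w U' X) ∧
        (∀ X, 0 ≤ a X) ∧ (∀ X, 0 ≤ ℓ X) ∧
        (∀ U, U ∈ {U : GaugeField (F.P J) 0 (Matrix.specialUnitaryGroup (Fin 2) ℂ) | PlaqSmall (θBal F.L γ (c * b₀) p₀ J) U} →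
          ∀ X, |w U X| ≤ wbar X) ∧
        (∀ X : Finset (PBond (F.P J) 0), ∀ e ∈ X, ∀ e' ∈ X, (e.src.tdist e'.src : ℝ) ≤ ℓ X) ∧
        (∀ X : Finset (PBond (F.P J) 0), ∑ X' ∈ Finset.univ.filter (fun X' => polyInc X' X),
            wbar X' * Real.exp (a X' + κ * ℓ X') ≤ a X) ∧
        (∀ e : PBond (F.P J) 0, a {e} ≤ Ψ J)) ∧
      (∀ X, ContinuousOn (fun U => w U X) {U : GaugeField (F.P J) 0 (Matrix.specialUnitaryGroup (Fin 2) ℂ) | PlaqSmall (θBal F.L γ (c * b₀) p₀ J) U}) ∧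
      ∀ᵐ U ∂fieldMeasure (F.P J) 0 (Matrix.specialUnitaryGroup (Fin 2) ℂ), PlaqSmall (θBal F.L γ (c * b₀) p₀ J) U →
        heightDensity F γ hJK Set.univ U = Real.exp cst * heightDensity F γ hJK (histGood F ℰp (θBal F.L γ b₀ p₀) K J) U *
          (polymerPartitionFunction polyInc (fun X : Finset (PBond (F.P J) 0) => ((w U X : ℝ) : ℂ)) Finset.univ).re) :
    ∃ (cst : ℝ) (w : GaugeField (F.P J) 0 (Matrix.specialUnitaryGroup (Fin 2) ℂ) → Finset (PBond (F.P J) 0) → ℝ),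
      (∃ (wbar a ℓ : Finset (PBond (F.P J) 0) → ℝ),
        (∀ U, w U ∅ = 0) ∧
        (∀ (X : Finset (PBond (F.P J) 0)) (U U' : GaugeField (F.P J) 0 (Matrix.specialUnitaryGroup (Fin 2) ℂ)),
          (∀ e ∈ X, U e = U' e) → w U X = w U' X) ∧
        (∀ X, 0 ≤ a X) ∧ (∀ X, 0 ≤ ℓ X) ∧
        (∀ U, U ∈ {U : GaugeField (F.P J) 0 (Matrix.specialUnitaryGroup (Fin 2) ℂ) | PlaqSmall (θBal F.L γ (c * b₀) p₀ J) U} →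
          ∀ X, |w U X| ≤ wbar X) ∧
        (∀ X : Finset (PBond (F.P J) 0), ∀ e ∈ X, ∀ e' ∈ X, (e.src.tdist e'.src : ℝ) ≤ ℓ X) ∧
        (∀ X : Finset (PBond (F.P J) 0), ∑ X' ∈ Finset.univ.filter (fun X' => polyInc X' X),
            wbar X' * Real.exp (a X' + κ * ℓ X') ≤ a X) ∧
        (∀ e : PBond (F.P J) 0, a {e} ≤ Ψ J)) ∧
      ∀ U : GaugeField (F.P J) 0 (Matrix.specialUnitaryGroup (Fin 2) ℂ), PlaqSmall (θBal F.L γ (c * b₀) p₀ J) U →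
        heightDensityCan F γ hJK Set.univ U =
          Real.exp cst * heightDensityCan F γ hJK (histGood F ℰp (θBal F.L γ b₀ p₀) K J) U *
            (polymerPartitionFunction polyInc (fun X : Finset (PBond (F.P J) 0) => ((w U X : ℝ) : ℂ)) Finset.univ).re := by
  obtain ⟨cst, w, hgas, hw, hae⟩ := h
  have hWo : IsOpen {U : GaugeField (F.P J) 0 (Matrix.specialUnitaryGroup (Fin 2) ℂ) | PlaqSmall (θBal F.L γ (c * b₀) p₀ J) U} :=
    Node00.isOpen_plaqSmall _
  obtain ⟨-, hid⟩ := heightDensityCan_gasIdentity_of_ae F hJK hWo Set.univ (histGood F ℰp (θBal F.L γ b₀ p₀) K J) cst (Ψ J) hκ w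
    hgas hw hae hR
  exact ⟨cst, w, hgas, fun U hU => hid U hU⟩

end Body

/-! ## §4 The door LFG^{ae}∘ ⟹ LFG^{can}∘ (whole display) -/

section AeDoor

open Classical in
/-- ★★ **LFG^{can}∘ (the hypothesis of ✓`…LargeFieldGasInteriorDoor.largeFieldFourPtIntCan_of_canInt`, VERBATIM) FROM ITS A.E. EDITION LFG^{ae}∘** — same prefix, same rows
(r1∘)(r2∘)(hgpos∘), same `KPGasOn` block; LFG^{ae}∘'s conclusion asks the gas identity only `dU`-A.E. on `W_J^{c}` between the honest densities `heightDensity`, plus CONTINUITY of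
the activities on `W_J^{c}`; §3 transfers it per `(J, K)`.  With ✓FILE 2: `stub_largeFieldFourPtIntCan := largeFieldFourPtIntCan_of_canInt (canInt_of_aeInt h)`.
[cite: Balaban1987RG1, (0.13) p.254; Balaban1989LargeFieldII, (1.90) p.388 and (1.100)-(1.101) p.390] -/
theorem canInt_of_aeInt
    (h : ∀ (L : ℕ), ∃ c₀ : ℝ, 0 < c₀ ∧ c₀ ≤ 1 ∧ ∀ (c : ℝ), 0 < c → c ≤ c₀ → ∃ pS : ℝ, ∀ (b₀ p₀ : ℝ), 0 < b₀ → pS ≤ p₀ → 0 < p₀ →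
      ∃ γ₁ : ℝ, 0 < γ₁ ∧ ∃ κ : ℝ, 0 < κ ∧ ∀ (F : T3Family) (γ : ℝ), F.L = L → 0 < γ → γ ≤ γ₁ →
        ∃ Ψ : ℕ → ℝ, (∀ J, 0 ≤ Ψ J) ∧ Tendsto (fun J : ℕ => (J : ℝ) * Ψ J) atTop (𝓝 0) ∧
          ∀ (J K : ℕ) (hJK : J ≤ K),
            {U : GaugeField (F.P J) 0 (Matrix.specialUnitaryGroup (Fin 2) ℂ) | PlaqSmall (θBal F.L γ (c * b₀) p₀ J) U} ⊆
              Node00.regSet (fieldMeasure (F.P J) 0 (Matrix.specialUnitaryGroup (Fin 2) ℂ)) (heightDensity F γ hJK Set.univ) →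
            (∀ U : GaugeField (F.P J) 0 (Matrix.specialUnitaryGroup (Fin 2) ℂ), PlaqSmall (θBal F.L γ (c * b₀) p₀ J) U →
                0 < heightDensityCan F γ hJK Set.univ U) →
            (∀ U : GaugeField (F.P J) 0 (Matrix.specialUnitaryGroup (Fin 2) ℂ), PlaqSmall (θBal F.L γ (c * b₀) p₀ J) U →
                0 < heightDensityCan F γ hJK (histGood F ℰp (θBal F.L γ b₀ p₀) K J) U) →
            ∃ (cst : ℝ) (w : GaugeField (F.P J) 0 (Matrix.specialUnitaryGroup (Fin 2) ℂ) → Finset (PBond (F.P J) 0) → ℝ),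
              (∃ (wbar a ℓ : Finset (PBond (F.P J) 0) → ℝ),
                (∀ U, w U ∅ = 0) ∧
                (∀ (X : Finset (PBond (F.P J) 0)) (U U' : GaugeField (F.P J) 0 (Matrix.specialUnitaryGroup (Fin 2) ℂ)),
                  (∀ e ∈ X, U e = U' e) → w U X = w U' X) ∧
                (∀ X, 0 ≤ a X) ∧ (∀ X, 0 ≤ ℓ X) ∧
                (∀ U, U ∈ {U : GaugeField (F.P J) 0 (Matrix.specialUnitaryGroup (Fin 2) ℂ) | PlaqSmall (θBal F.L γ (c * b₀) p₀ J) U} →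
                  ∀ X, |w U X| ≤ wbar X) ∧
                (∀ X : Finset (PBond (F.P J) 0), ∀ e ∈ X, ∀ e' ∈ X, (e.src.tdist e'.src : ℝ) ≤ ℓ X) ∧
                (∀ X : Finset (PBond (F.P J) 0), ∑ X' ∈ Finset.univ.filter (fun X' => polyInc X' X),
                    wbar X' * Real.exp (a X' + κ * ℓ X') ≤ a X) ∧
                (∀ e : PBond (F.P J) 0, a {e} ≤ Ψ J)) ∧
              (∀ X, ContinuousOn (fun U => w U X) {U : GaugeField (F.P J) 0 (Matrix.specialUnitaryGroup (Fin 2) ℂ) | PlaqSmall (θBal F.L γ (c * b₀) p₀ J) U}) ∧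
              ∀ᵐ U ∂fieldMeasure (F.P J) 0 (Matrix.specialUnitaryGroup (Fin 2) ℂ), PlaqSmall (θBal F.L γ (c * b₀) p₀ J) U →
                heightDensity F γ hJK Set.univ U = Real.exp cst * heightDensity F γ hJK (histGood F ℰp (θBal F.L γ b₀ p₀) K J) U *
                  (polymerPartitionFunction polyInc (fun X : Finset (PBond (F.P J) 0) => ((w U X : ℝ) : ℂ)) Finset.univ).re) :
    ∀ (L : ℕ), ∃ c₀ : ℝ, 0 < c₀ ∧ c₀ ≤ 1 ∧ ∀ (c : ℝ), 0 < c → c ≤ c₀ → ∃ pS : ℝ, ∀ (b₀ p₀ : ℝ), 0 < b₀ → pS ≤ p₀ → 0 < p₀ →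
      ∃ γ₁ : ℝ, 0 < γ₁ ∧ ∃ κ : ℝ, 0 < κ ∧ ∀ (F : T3Family) (γ : ℝ), F.L = L → 0 < γ → γ ≤ γ₁ →
        ∃ Ψ : ℕ → ℝ, (∀ J, 0 ≤ Ψ J) ∧ Tendsto (fun J : ℕ => (J : ℝ) * Ψ J) atTop (𝓝 0) ∧
          ∀ (J K : ℕ) (hJK : J ≤ K),
            {U : GaugeField (F.P J) 0 (Matrix.specialUnitaryGroup (Fin 2) ℂ) | PlaqSmall (θBal F.L γ (c * b₀) p₀ J) U} ⊆
              Node00.regSet (fieldMeasure (F.P J) 0 (Matrix.specialUnitaryGroup (Fin 2) ℂ)) (heightDensity F γ hJK Set.univ) →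
            (∀ U : GaugeField (F.P J) 0 (Matrix.specialUnitaryGroup (Fin 2) ℂ), PlaqSmall (θBal F.L γ (c * b₀) p₀ J) U →
                0 < heightDensityCan F γ hJK Set.univ U) →
            (∀ U : GaugeField (F.P J) 0 (Matrix.specialUnitaryGroup (Fin 2) ℂ), PlaqSmall (θBal F.L γ (c * b₀) p₀ J) U →
                0 < heightDensityCan F γ hJK (histGood F ℰp (θBal F.L γ b₀ p₀) K J) U) →
            ∃ (cst : ℝ) (w : GaugeField (F.P J) 0 (Matrix.specialUnitaryGroup (Fin 2) ℂ) → Finset (PBond (F.P J) 0) → ℝ),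
              (∃ (wbar a ℓ : Finset (PBond (F.P J) 0) → ℝ),
                (∀ U, w U ∅ = 0) ∧
                (∀ (X : Finset (PBond (F.P J) 0)) (U U' : GaugeField (F.P J) 0 (Matrix.specialUnitaryGroup (Fin 2) ℂ)),
                  (∀ e ∈ X, U e = U' e) → w U X = w U' X) ∧
                (∀ X, 0 ≤ a X) ∧ (∀ X, 0 ≤ ℓ X) ∧
                (∀ U, U ∈ {U : GaugeField (F.P J) 0 (Matrix.specialUnitaryGroup (Fin 2) ℂ) | PlaqSmall (θBal F.L γ (c * b₀) p₀ J) U} →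
                  ∀ X, |w U X| ≤ wbar X) ∧
                (∀ X : Finset (PBond (F.P J) 0), ∀ e ∈ X, ∀ e' ∈ X, (e.src.tdist e'.src : ℝ) ≤ ℓ X) ∧
                (∀ X : Finset (PBond (F.P J) 0), ∑ X' ∈ Finset.univ.filter (fun X' => polyInc X' X),
                    wbar X' * Real.exp (a X' + κ * ℓ X') ≤ a X) ∧
                (∀ e : PBond (F.P J) 0, a {e} ≤ Ψ J)) ∧
              ∀ U : GaugeField (F.P J) 0 (Matrix.specialUnitaryGroup (Fin 2) ℂ), PlaqSmall (θBal F.L γ (c * b₀) p₀ J) U →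
                heightDensityCan F γ hJK Set.univ U =
                  Real.exp cst * heightDensityCan F γ hJK (histGood F ℰp (θBal F.L γ b₀ p₀) K J) U *
                    (polymerPartitionFunction polyInc (fun X : Finset (PBond (F.P J) 0) => ((w U X : ℝ) : ℂ)) Finset.univ).re := by
  intro L
  obtain ⟨c₀, hc₀, hc₀1, H⟩ := h L
  refine ⟨c₀, hc₀, hc₀1, fun c hc hcc₀ => ?_⟩
  obtain ⟨pS, H⟩ := H c hc hcc₀
  refine ⟨pS, fun b₀ p₀ hb hpS hp => ?_⟩
  obtain ⟨γ₁, hγ₁, κ, hκ, H⟩ := H b₀ p₀ hb hpS hp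
  refine ⟨γ₁, hγ₁, κ, hκ, fun F γ hFL hγ hγle => ?_⟩
  obtain ⟨Ψ, hΨ0, hΨt, H⟩ := H F γ hFL hγ hγle
  refine ⟨Ψ, hΨ0, hΨt, fun J K hJK hR hP hgpos => ?_⟩
  exact canInt_body_of_ae F b₀ p₀ c hJK hκ.le Ψ hR (H J K hJK hR hP hgpos)

end AeDoor

end Summit.QuantumFields.YangMills.Theorems.FluctuationComparisonRegPrIntLLargeFieldGasCanonicalTransfer

end
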